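import Summits.ABC.IUTFork.Repair.RHHeightClassDoor
import Summits.ABC.IUTFork.Cor312GenuineKDeepPlace
import Summits.ABC.IUTFork.Cor312IdentifiedDHWitness
import HarnessLib

/-!
# D-0079 RESCUE sub-cell R-H, ROUND 2 (D-0107) Q2(8): «S restricted to Σ₈ ⟹ Cor. 3.12's hull clause ⟹ …» for the DATUM-stratum Σ₈ of
# row 8 «heightclass» — `HBand X` ALONE gives the (xi-f) hull clause at `settingPrVolSharp X …` for EVERY realising idele pair:
# the row-8 door with ALL its dictionary / idele-profile binders DISCHARGED

PROOF-ONLY file (D-0012: 0 definitions, 0 `Prop` facts; abc-iut cell, rung LADDER-ABC:A2.RESCUE.H; seat abc-iut-rh-typ-8 gen 3 = R-H ROUND 2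
TRANCHE 1 payload (4) «row 8: Q2(8)», director-abc g3 2026-08-26T19:46:32Z; lead abc-iut-rh-lead g0, `plan/rescue/R-H/ROUND2/START-HERE.md`
v1.0 §0–§2: row 8 is a DATUM-stratum row — Σ₈ = «HEX: k ≤ k₀(p,e_w,l)» is the closed form (`RHHeightClass.hexSlice_iff`, p459046) of the
datum-level hypothesis `RHHeightClass.HBand X` itself, so «S restricted to Σ₈» is S_H demanded only at the data satisfying `HBand`, and
inside such a datum NO cell is off-Σ (Q1 word «MOOT-ON-DATUM-Σ(8)»)). TAKES NO SIDE on [IUTchIII] Cor. 3.12 or on any author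
(Mochizuki / Scholze–Stix / Joshi / Dupuy–Hilado); `HBand` is an R-H CANDIDATE = a claim-tagged HYPOTHESIS (abc-iut-lens-strengthen-1, filed
p459046), never a Literature fact; nothing here asserts abc proved or refuted; typed ≠ proved; instantiated ≠ endorsed.

WHAT IS PROVED (tree names only; the row-1 door `RHHeightClassDoor.exists_qPinned_and_hull_settingPrVolSharp_of_hBand` p463273 carried the
dictionary `(e_p, r_p, ϖ, m_q)` and the idele profile as ELEVEN binders — here they are all discharged):
* §1 `slotReachWindow_congr` — abc-iut-lens-wuc-1's `RHSlotReach.SlotReachWindow` only reads its dictionary at fibres that carry a BAD place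
  (its clauses are indexed by bad last slots `w ∣ p` and donors over the same `p`): two dictionaries agreeing there give the same window.
* §2 `qRegion_subset_thetaHull_settingPrVolSharp_of_slotReachWindow` — abc-iut-rp-d3's door p462301 in COLUMN-FREE form: the (xi-f) hull clause
  `qRegion ⊆ thetaHull` at EVERY packet `(j, v_ℚ)` of `settingPrVolSharp` (labels of `𝔽_l^⋇` by `multiReach_of_slotReachWindow` + abc-iut-w5-d107
  `qRegion_subset_thetaHull_settingDHVolSharp_of_multiReach`; label `0` by abc-iut-w5-d236's trivial movers for integral `t_q`) — the RIGHT-HAND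
  side of C-cert-1's `Conditional.Antecedent.exists_qPinned_and_hull_iff`, i.e. VERBATIM the body of the binder `hSHw` of the certificate of record
  `Conditional.abc_of_SH_v10K_window` (p447945: `PilotKummerCompatHull … (fun _ => qRegion …) qK`).
* §3 THE DICTIONARY FROM THE CANDIDATE. `exists_uniformIdx_of_hBand` — from `HBand X` alone: per prime ONE index `e_p ≥ 1` equal to `ramIdx` at
  EVERY place over a prime that carries a bad place (the candidate's uniform-fibre clause); `exists_lowerCert` — ONE exponent `r_p` that is a LOWER
  BOUND of every certified value `CertVal p e_p` and is itself certified (untied: the strict minimum `r♯`, `RHHeightClass.le_of_certVal_of_strictMin`;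
  tied: `r_p = e_p`, `RHHeightClassGlue.hrK_of_tie`) — classical choice, no table. `intOrder_cast_eq_qPilot` — the INTEGER Kummer orders `m_q(w) = ord_w(q)/(2l) = P_q(w)`
  under `TwoMulLDvdOrdq X` ([IUTchI] Ex. 3.2 (iv); a THEOREM at genuine data: `Cor312Prov.twoMulLDvdOrdq_pilotDataOfK`).
* §4 THE IDELE PROFILE FROM REALISATION. `norm_eq_uniformizer_zpow_of_log` — a realising log-identity `log ‖a‖ = −c·ln|κ(w)|/n_w` with `c = N ∈ ℤ`
  reads `‖a‖ = ‖ϖ_w‖^N` for the norm uniformizer `‖ϖ_w‖ = p^{−1/e(w|p)}` (`Cor312Prov.norm_eq_rpow_of_log_norm_eq`, `RHHeightClassGlue.absRamificationIdx_kOf`);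
  `norm_le_one_of_log_realising` — realising q-ideles are integral (`ValLine.qPilot_nonneg`).
* §5 **`qRegion_subset_thetaHull_settingPrVolSharp_of_hBand`** — for ANY Dupuy–Hilado pilot datum `X` with `TwoMulLDvdOrdq X`, ANY context binders,
  and ANY idele pair `(t_q, t_Θ)` REALISING `(P_q, P_Θ)` (units off `S`): `HBand X ⟹ ∀ j v_ℚ, qRegion ⊆ thetaHull` at `settingPrVolSharp X …`.
  Per point the dictionary is `e_x = ramIdx`, `n₀ = 1` (certified by abc-iut-rh-typ-12's `RHSlotReach.exists_hsharp_one`), `λ_x = −r_p/e_p` over primes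
  with a bad place (`RHHeightClassGlue.exists_mem_logUnits_rpow_le_of_certVal`, `p` odd by the candidate) and `λ_x = −(⌊e_x/(p−1)⌋+1)/e_x` elsewhere
  (`RHHeightClassGlue.exists_mem_logUnits_rpow_le_div_succ`, any `p`); §1 moves abc-iut-rp-m2's uniform window `slotReachWindow_of_hBand` (p460910) onto it.
* companion `Repair/RHHeightClassSigmaChosen.lean`: the same at the GENUINE bed `pilotDataOfK D K` (Ex. 3.2 (iv) = `Cor312Prov.twoMulLDvdOrdq_pilotDataOfK`)
  and at the CHOSEN realising ideles of the certificates of record («InSigma₈(D) ⟹ S_H-window(D)», InSigma₈ := `HBand (pilotDataOfK D K)` verbatim),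
  the per-datum Cor. 3.12 and the certificate composition along `Conditional.abc_of_SH_v10K_window`.
HONEST SCOPE: OUR typed objects throughout (Dupuy–Hilado's (Ind2) = all `ℤ_p`-lattice automorphisms of the log-shell, STRONGER-THAN-PRINT;
abc-iut-c312-7's SHARP pilot boxes; the hull-level reading of Step (xi-f)); `HBand` is refuted pooled on the genuine table (k1 56.7 %, ROUND1.tsv row 8)
and holds exactly on Σ₈ — this file says what follows for the data IN Σ₈, nothing about the data outside it (Q3's object). No new `Prop` fact; standard
axioms. [cite: DupuyHilado2025, §3.3, §3.4, §3.9, §4.9] [cite: WeilBNT1967, Ch. II §2, Th. 1] [cite: NeukirchANT1999, Ch. II Prop. (5.5), Prop. (6.8)]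
[cite: Mochizuki2012, IUTchI Ex. 3.2 (iv) p. 71; IUTchIII Cor. 3.12 Step (xi-f) p. 184; IUTchIV Prop. 1.2 (i) p. 10] [claim: Mochizuki2012, status: disputed]
-/

noncomputable section

open Set Function
open scoped Pointwise

namespace Summit.ABC.IUTFork.Repair.RHHeightClassSigma

open Thm311 Thm311.Real Cor312 Cor312.Setting Cor312Vol Literature.IUT.LogThetaLattice Literature.IUT.LogVolume
open Literature.NumberTheory.NumberFields NumberField IsDedekindDomain Metric RHLevelMover RHSlotReach

/-! ## §1. The slot-reach window only reads its dictionary at fibres with a bad place -/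

/-- **Dictionary transfer for `SlotReachWindow`.** The clauses of abc-iut-lens-wuc-1's window are indexed by a BAD last slot `w ∣ p` and donor
slots over the SAME prime `p`; so if two dictionaries `(e, n₀, λ)` and `(e', n₀', λ')` agree at every fibre point over every prime that carries a
bad place, the window for one is the window for the other (same `mΘ`, `m_q`). [folklore] -/
theorem slotReachWindow_congr {lstar : ℕ} {Fib : Nat.Primes → Type} {bad : ∀ pp, Fib pp → Prop}
    {e e' n₀ n₀' : ∀ pp, Fib pp → ℕ} {lam lam' : ∀ pp, Fib pp → ℝ}
    {mΘ : ∀ pp, Fin lstar → Fib pp → ℤ} {mq : ∀ pp, Fib pp → ℤ}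
    (he : ∀ pp w, bad pp w → ∀ x : Fib pp, e' pp x = e pp x)
    (hn : ∀ pp w, bad pp w → ∀ x : Fib pp, n₀' pp x = n₀ pp x)
    (hl : ∀ pp w, bad pp w → ∀ x : Fib pp, lam' pp x = lam pp x)
    (h : SlotReachWindow lstar Fib bad e n₀ lam mΘ mq) : SlotReachWindow lstar Fib bad e' n₀' lam' mΘ mq := by
  intro pp i w hw x
  have h' := h pp i w hw x
  simp only [he pp w hw, hn pp w hw, hl pp w hw]
  exact h'

/-! ## §2. abc-iut-rp-d3's door in column-free form: `SlotReachWindow` ⟹ `qRegion ⊆ thetaHull` at every packet -/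

section Setting

variable {F : Type} [Field F] [NumberField F] (X : PilotData F) {logv : PadicLogs F} (hlog : LogvAnalytic logv)
  (M : Type) [Field M] [NumberField M]
  (archPk : ∀ (j : (thetaIndex X).Label) (vQ : (thetaIndex X).VQ), Set ((logShellsDH X logv).Packet j vQ))
  (archSub : ∀ (j : (thetaIndex X).Label) (v : (thetaIndex X).V),
    Set ((logShellsDH X logv).Packet j ((thetaIndex X).over v)))
  (Ψ : ℤ → ∀ v : (thetaIndex X).V, v ∈ (thetaIndex X).Vbad → Set ((logShellsDH X logv).StarPacket v))
  (act : ℤ → ∀ v : (thetaIndex X).V, v ∈ (thetaIndex X).Vbad →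
    (logShellsDH X logv).StarPacket v → Module.End ℚ ((logShellsDH X logv).StarPacket v))
  (Mmod : ℤ → ∀ j : (thetaIndex X).LabelStar, Set ((logShellsDH X logv).GlobalPacket j.1))
  (region : ℤ → ∀ j : (thetaIndex X).LabelStar, FinDivisor M → ∀ vQ : (thetaIndex X).VQ,
    Set ((logShellsDH X logv).Packet j.1 vQ))
  (n : ℤ) {HT : Type} {LogLink : HT → HT → Type} {IsFull : ∀ {s t : HT}, LogLink s t → Prop}
  (lat : LGPGaussianLogThetaLattice LogLink IsFull)
  {Frd : Type} {IsoF : Frd → Frd → Type} {Ob : Frd → Type} {realify : Frd → Frd} {Strip : Type}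
  {IsoS : Strip → Strip → Type} {Mv : ∀ v : (thetaIndex X).V, v ∈ (thetaIndex X).Vbad → Type}
  [∀ v h, Monoid (Mv v h)]
  (sig : GlobalLGPFrobenioidSignature (thetaIndex X).lstar (thetaIndex X).V (· ∈ (thetaIndex X).Vbad)
    Frd IsoF Ob realify Strip IsoS Mv)
  (split : SplittingMonoids Mv) {ObΔ : Type} {N : ∀ v : (thetaIndex X).V, v ∈ (thetaIndex X).Vbad → Type}
  [∀ v h, Monoid (N v h)] (qData : QPilotData ObΔ N)
  (tq : ∀ (pp : Nat.Primes) (x : (thetaIndex X).Fibre (.inr pp)), haveI : Fact (pp : ℕ).Prime := ⟨pp.2⟩; kOf X pp.1 x)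
  (t : ∀ (pp : Nat.Primes) (_ : Fin X.lstar) (x : (thetaIndex X).Fibre (.inr pp)),
    haveI : Fact (pp : ℕ).Prime := ⟨pp.2⟩; kOf X pp.1 x)
  (htq0 : ∀ pp x, tq pp x ≠ 0)
  (htq1 : ∀ (pp : Nat.Primes) (x : (thetaIndex X).Fibre (.inr pp)),
    haveI : Fact (pp : ℕ).Prime := ⟨pp.2⟩; placeOf X pp.1 x ∉ X.S → ‖tq pp x‖ = 1)
  -- a numeric dictionary in the sense of abc-iut-lens-wuc-1 (per place: index, inner conductor, outer exponent, uniformizer, orders)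
  (e n₀ : ∀ pp : Nat.Primes, (thetaIndex X).Fibre (.inr pp) → ℕ)
  (lam : ∀ pp : Nat.Primes, (thetaIndex X).Fibre (.inr pp) → ℝ)
  (ϖ : ∀ (pp : Nat.Primes) (x : (thetaIndex X).Fibre (.inr pp)), haveI : Fact (pp : ℕ).Prime := ⟨pp.2⟩; kOf X pp.1 x)
  (mΘ : ∀ pp : Nat.Primes, Fin (thetaIndex X).lstar → (thetaIndex X).Fibre (.inr pp) → ℤ)
  (mq : ∀ pp : Nat.Primes, (thetaIndex X).Fibre (.inr pp) → ℤ)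

/-- **abc-iut-rp-d3's door, COLUMN-FREE.** Under a numeric dictionary with its per-place certificates and an idele pair with the stated norm
profile, abc-iut-lens-wuc-1's `SlotReachWindow` gives the (xi-f) hull clause `qRegion ⊆ thetaHull` at EVERY packet `(j, v_ℚ)` of
`settingPrVolSharp X …` — the right-hand side of C-cert-1's `Conditional.Antecedent.exists_qPinned_and_hull_iff`, with no lattice columns in the
statement. PROOF = the body of `RHSlotReachGlue.exists_qPinned_and_hull_settingPrVolSharp_of_slotReachWindow` (p462301) before its last wrapping step:
labels of `𝔽_l^⋇` by `multiReach_of_slotReachWindow` and abc-iut-w5-d107's `qRegion_subset_thetaHull_settingDHVolSharp_of_multiReach` (`…_inl` at the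
archimedean packets), the label `0` by abc-iut-w5-d236's trivial movers for integral `t_q`. [cite: WeilBNT1967, Ch. II §2, Th. 1]
[cite: DupuyHilado2025, §3.9, §4.9] [claim: Mochizuki2012, status: disputed] -/
theorem qRegion_subset_thetaHull_settingPrVolSharp_of_slotReachWindow (htqle : ∀ pp x, ‖tq pp x‖ ≤ 1)
    (he : ∀ pp x, 1 ≤ e pp x)
    (hϖ : ∀ (pp : Nat.Primes) (x : (thetaIndex X).Fibre (.inr pp)), haveI : Fact (pp : ℕ).Prime := ⟨pp.2⟩
      ‖ϖ pp x‖ = (pp : ℝ) ^ (-(1 : ℝ) / (e pp x : ℝ)))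
    (hsharp : ∀ (pp : Nat.Primes) (x : (thetaIndex X).Fibre (.inr pp)), haveI : Fact (pp : ℕ).Prime := ⟨pp.2⟩
      ∃ u : kOf X pp.1 x, ‖u‖ ≤ ‖ϖ pp x‖ ^ ((n₀ pp x : ℤ) - 1) ∧ u ∉ (logUnits (kOf X pp.1 x) : Set (kOf X pp.1 x)))
    (hrad : ∀ (pp : Nat.Primes) (x : (thetaIndex X).Fibre (.inr pp)), haveI : Fact (pp : ℕ).Prime := ⟨pp.2⟩
      ∃ z ∈ (logUnits (kOf X pp.1 x) : Set (kOf X pp.1 x)), (pp : ℝ) ^ (lam pp x) ≤ ‖z‖)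
    (ht1 : ∀ (pp : Nat.Primes) (i : Fin X.lstar) (x : (thetaIndex X).Fibre (.inr pp)),
      haveI : Fact (pp : ℕ).Prime := ⟨pp.2⟩; placeOf X pp.1 x ∉ X.S → ‖t pp i x‖ = 1)
    (hΘ : ∀ (pp : Nat.Primes) (i : Fin X.lstar) (w : (thetaIndex X).Fibre (.inr pp)), haveI : Fact (pp : ℕ).Prime := ⟨pp.2⟩
      placeOf X pp.1 w ∈ X.S → ‖t pp i w‖ = ‖ϖ pp w‖ ^ (mΘ pp i w))
    (hq : ∀ (pp : Nat.Primes) (w : (thetaIndex X).Fibre (.inr pp)), haveI : Fact (pp : ℕ).Prime := ⟨pp.2⟩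
      placeOf X pp.1 w ∈ X.S → ‖tq pp w‖ = ‖ϖ pp w‖ ^ (mq pp w))
    (hH : SlotReachWindow (thetaIndex X).lstar (fun pp => (thetaIndex X).Fibre (.inr pp))
      (fun pp w => haveI : Fact (pp : ℕ).Prime := ⟨pp.2⟩; placeOf X pp.1 w ∈ X.S) e n₀ lam mΘ mq) :
    ∀ (j : (thetaIndex X).Label) (vQ : (thetaIndex X).VQ),
      (settingPrVolSharp X hlog M archPk archSub Ψ act Mmod region n lat sig split qData tq t htq0 htq1).qRegion j vQ ⊆
        (settingPrVolSharp X hlog M archPk archSub Ψ act Mmod region n lat sig split qData tq t htq0 htq1).thetaHull j vQ := by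
  intro j vQ
  haveI hne : ∀ pp : Nat.Primes, Fact (pp : ℕ).Prime := fun pp => ⟨pp.2⟩
  by_cases hj : 0 < (j : ℕ)
  · -- a label of `𝔽_l^⋇`: multi-reach at every packet over every prime
    have hj' : j = labelSucc ⟨(j : ℕ) - 1, by have := j.2; simp only [thetaIndex] at this ⊢; omega⟩ := by
      ext; simp only [labelSucc, Fin.val_succ]; omega
    rw [hj']
    cases vQ with
    | inl u =>
      exact qRegion_subset_thetaHull_settingDHVolSharp_inl X hlog M archPk archSub Ψ act Mmod region n lat sig split qData tq t htq0
        htq1 (labelSucc _) u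
    | inr pp =>
      exact qRegion_subset_thetaHull_settingDHVolSharp_of_multiReach X hlog M archPk archSub Ψ act Mmod region n lat sig split qData
        tq t htq0 htq1 pp _ (RHSlotReachGlue.multiReach_of_slotReachWindow X hlog tq t e n₀ lam ϖ mΘ mq htq1 he hϖ hsharp hrad ht1
          hΘ hq hH pp _)
  · -- the label `0`: the Θ-idele is `1`, trivial movers for integral `t_q`
    refine qRegion_subset_thetaHull_settingDHVolSharp_of_movers X hlog M archPk archSub Ψ act Mmod region n lat sig split qData tq t
      htq0 htq1 j vQ fun pp x => exists_mover_of_norm_le X hlog tq t pp j x ?_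
    unfold labelIdele
    rw [dif_neg hj, norm_one]
    exact htqle pp x

end Setting

/-! ## §3. The dictionary READ OFF the candidate: uniform index, certified lower exponent, integer Kummer orders -/

section Dictionary

variable {F : Type} [Field F] [NumberField F] (X : PilotData F)

/-- **Uniform ramification index per prime, from `HBand X`.** The candidate's uniform-fibre clause gives, for every prime `p` UNDER A BAD PLACE,
one index `e_p = ramIdx F x` for EVERY place `x ∣ p` of the Θ-index fibre; at the other primes (where the candidate is silent) we put `e_p := 1`
(never read: §1). Classical choice, no table. [claim: Mochizuki2012, status: disputed] for the candidate; the extraction is bookkeeping. -/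
theorem exists_uniformIdx_of_hBand (hH : RHHeightClass.HBand X) :
    ∃ eK : Nat.Primes → ℕ, (∀ pp, 1 ≤ eK pp) ∧
      ∀ (pp : Nat.Primes) (w : (thetaIndex X).Fibre (.inr pp)), haveI : Fact (pp : ℕ).Prime := ⟨pp.2⟩
        placeOf X pp.1 w ∈ X.S → ∀ x : (thetaIndex X).Fibre (.inr pp), ramIdx F (placeOf X pp.1 x) = eK pp := by
  classical
  haveI hne : ∀ pp : Nat.Primes, Fact (pp : ℕ).Prime := fun pp => ⟨pp.2⟩
  have i₀ : Fin X.lstar := ⟨0, by have := X.two_le_lstar; omega⟩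
  refine ⟨fun pp => if h : ∃ w : (thetaIndex X).Fibre (.inr pp), placeOf X pp.1 w ∈ X.S
      then ramIdx F (placeOf X pp.1 h.choose) else 1, fun pp => ?_, fun pp w hw x => ?_⟩
  · dsimp only
    split_ifs with h
    · exact Nat.one_le_iff_ne_zero.2 (ramIdx_ne_zero F _)
    · exact le_rfl
  · have h : ∃ w : (thetaIndex X).Fibre (.inr pp), placeOf X pp.1 w ∈ X.S := ⟨w, hw⟩
    dsimp only
    rw [dif_pos h]
    obtain ⟨-, hunif, -⟩ := hH pp i₀ w hw
    rw [hunif x, hunif h.choose]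

/-- **A certified LOWER exponent at `(p, e)`** (pure arithmetic of the candidate's `CertVal`): some `r` with `CertVal p e r` that is `≤` every
certified value — untied: the strict minimum `r♯` (`RHHeightClass.le_of_certVal_of_strictMin`); tied: the fallback `r = e`
(`RHHeightClassGlue.hrK_of_tie`). [folklore] -/
theorem exists_lowerCert (p e : ℕ) (he : 1 ≤ e) :
    ∃ r : ℤ, RHHeightClass.CertVal p e r ∧ ∀ r' : ℤ, RHHeightClass.CertVal p e r' → r ≤ r' := by
  classical
  by_cases h : ∃ r : ℤ, RHHeightClass.StrictMinPow p e r
  · exact ⟨h.choose, Or.inl h.choose_spec, fun r' hr' => RHHeightClass.le_of_certVal_of_strictMin he h.choose_spec hr'⟩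
  · exact ⟨e, Or.inr rfl, fun r' hr' => RHHeightClassGlue.hrK_of_tie (fun r hr => h ⟨r, hr⟩) r' hr'⟩

/-- **INTEGER Kummer orders under [IUTchI] Ex. 3.2 (iv).** If `2l ∣ ord_w(q_w)` on `S` (`Cor312Prov.TwoMulLDvdOrdq X`; a THEOREM at the genuine bed,
`Cor312Prov.twoMulLDvdOrdq_pilotDataOfK`), the integer `m_q(w) := ord_w(q_w)/(2l)` IS the coefficient `P_q(w)` (Dupuy–Hilado §3.3).
[cite: Mochizuki2012, IUTchI Ex. 3.2 (iv) p. 71] [cite: DupuyHilado2025, §3.3] -/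
theorem intOrder_cast_eq_qPilot (h2l : Cor312Prov.TwoMulLDvdOrdq X) {w : HeightOneSpectrum (𝓞 F)} (hw : w ∈ X.S) :
    ((X.ordq w / (2 * (X.l : ℤ)) : ℤ) : ℝ) = X.qPilot w := by
  rw [X.qPilot_apply_of_mem hw]
  obtain ⟨c, hc⟩ := h2l w hw
  have hl : (2 * (X.l : ℤ)) ≠ 0 := by have := X.five_le_l; omega
  have hl0 : (X.l : ℝ) ≠ 0 := by exact_mod_cast (show X.l ≠ 0 by have := X.five_le_l; omega)
  rw [hc, Int.mul_ediv_cancel_left _ hl]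
  push_cast
  field_simp

end Dictionary

/-! ## §4. The idele profile READ OFF realisation: norms as powers of the norm uniformizer -/

section Profile

variable {F : Type} [Field F] [NumberField F] (X : PilotData F)

/-- **Realising log-identity ⟹ power of the uniformizer.** In `K_x = kOf X p x` (`w = placeOf X p x`): if `log ‖a‖ = −c·ln|κ(w)|/n_w` with
`c = N ∈ ℤ` and `‖ϖ‖ = p^{−1/e(w|p)}`, then `‖a‖ = ‖ϖ‖^N` (`Cor312Prov.norm_eq_rpow_of_log_norm_eq`: `‖a‖ = p^{−c/e(K_x/ℚ_p)}`, and
`e(K_x/ℚ_p) = ramIdx F w`, `RHHeightClassGlue.absRamificationIdx_kOf`). [cite: DupuyHilado2025, §2.4.2, §3.4] [cite: NeukirchANT1999, Ch. II Prop. (6.8)] -/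
theorem norm_eq_uniformizer_zpow_of_log (pp : Nat.Primes) (x : (thetaIndex X).Fibre (.inr pp))
    {a ϖ : haveI : Fact (pp : ℕ).Prime := ⟨pp.2⟩; kOf X pp.1 x} (ha : a ≠ 0)
    (hϖ : haveI : Fact (pp : ℕ).Prime := ⟨pp.2⟩; ‖ϖ‖ = (pp : ℝ) ^ (-(1 : ℝ) / (ramIdx F (placeOf X pp.1 x) : ℝ)))
    {c : ℝ} {N : ℤ} (hN : (N : ℝ) = c)
    (h : haveI : Fact (pp : ℕ).Prime := ⟨pp.2⟩
      Real.log ‖a‖ = -c * logNorm F (placeOf X pp.1 x) / localDegree F (placeOf X pp.1 x)) :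
    ‖a‖ = ‖ϖ‖ ^ N := by
  haveI : Fact (pp : ℕ).Prime := ⟨pp.2⟩
  have hp0 : (0 : ℝ) ≤ (pp : ℝ) := by positivity
  have h1 := Cor312Prov.norm_eq_rpow_of_log_norm_eq X pp x ha h
  rw [RHHeightClassGlue.absRamificationIdx_kOf X pp.1 x] at h1
  rw [h1, ← Real.rpow_intCast, hϖ, ← Real.rpow_mul hp0, hN]
  congr 1
  ring

/-- **Realising q-ideles are integral**: `log ‖t_{q,x}‖ = −P_q(w)·ln|κ(w)|/n_w` with `P_q(w) ≥ 0` gives `‖t_{q,x}‖ ≤ 1`. [cite: DupuyHilado2025, §3.4] -/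
theorem norm_le_one_of_log_realising (pp : Nat.Primes) (x : (thetaIndex X).Fibre (.inr pp))
    {a : haveI : Fact (pp : ℕ).Prime := ⟨pp.2⟩; kOf X pp.1 x} (ha : a ≠ 0)
    (h : haveI : Fact (pp : ℕ).Prime := ⟨pp.2⟩
      Real.log ‖a‖ = -(X.qPilot (placeOf X pp.1 x)) * logNorm F (placeOf X pp.1 x) / localDegree F (placeOf X pp.1 x)) :
    ‖a‖ ≤ 1 := by
  haveI : Fact (pp : ℕ).Prime := ⟨pp.2⟩
  have hp1 : (1 : ℝ) ≤ (pp : ℝ) := by exact_mod_cast pp.2.one_lt.le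
  have h1 := Cor312Prov.norm_eq_rpow_of_log_norm_eq X pp x ha h
  rw [h1]
  exact Real.rpow_le_one_of_one_le_of_nonpos hp1 (neg_nonpos.2 (div_nonneg (ValLine.qPilot_nonneg X _) (Nat.cast_nonneg _)))

end Profile

/-! ## §5. `HBand X` ALONE ⟹ the (xi-f) hull clause at every packet, for every realising idele pair -/

section Main

variable {F : Type} [Field F] [NumberField F] (X : PilotData F) {logv : PadicLogs F} (hlog : LogvAnalytic logv)
  (M : Type) [Field M] [NumberField M]
  (archPk : ∀ (j : (thetaIndex X).Label) (vQ : (thetaIndex X).VQ), Set ((logShellsDH X logv).Packet j vQ))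
  (archSub : ∀ (j : (thetaIndex X).Label) (v : (thetaIndex X).V),
    Set ((logShellsDH X logv).Packet j ((thetaIndex X).over v)))
  (Ψ : ℤ → ∀ v : (thetaIndex X).V, v ∈ (thetaIndex X).Vbad → Set ((logShellsDH X logv).StarPacket v))
  (act : ℤ → ∀ v : (thetaIndex X).V, v ∈ (thetaIndex X).Vbad →
    (logShellsDH X logv).StarPacket v → Module.End ℚ ((logShellsDH X logv).StarPacket v))
  (Mmod : ℤ → ∀ j : (thetaIndex X).LabelStar, Set ((logShellsDH X logv).GlobalPacket j.1))
  (region : ℤ → ∀ j : (thetaIndex X).LabelStar, FinDivisor M → ∀ vQ : (thetaIndex X).VQ,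
    Set ((logShellsDH X logv).Packet j.1 vQ))
  (n : ℤ) {HT : Type} {LogLink : HT → HT → Type} {IsFull : ∀ {s t : HT}, LogLink s t → Prop}
  (lat : LGPGaussianLogThetaLattice LogLink IsFull)
  {Frd : Type} {IsoF : Frd → Frd → Type} {Ob : Frd → Type} {realify : Frd → Frd} {Strip : Type}
  {IsoS : Strip → Strip → Type} {Mv : ∀ v : (thetaIndex X).V, v ∈ (thetaIndex X).Vbad → Type}
  [∀ v h, Monoid (Mv v h)]
  (sig : GlobalLGPFrobenioidSignature (thetaIndex X).lstar (thetaIndex X).V (· ∈ (thetaIndex X).Vbad)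
    Frd IsoF Ob realify Strip IsoS Mv)
  (split : SplittingMonoids Mv) {ObΔ : Type} {N : ∀ v : (thetaIndex X).V, v ∈ (thetaIndex X).Vbad → Type}
  [∀ v h, Monoid (N v h)] (qData : QPilotData ObΔ N)
  (tq : ∀ (pp : Nat.Primes) (x : (thetaIndex X).Fibre (.inr pp)), haveI : Fact (pp : ℕ).Prime := ⟨pp.2⟩; kOf X pp.1 x)
  (t : ∀ (pp : Nat.Primes) (_ : Fin X.lstar) (x : (thetaIndex X).Fibre (.inr pp)),
    haveI : Fact (pp : ℕ).Prime := ⟨pp.2⟩; kOf X pp.1 x)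
  (htq0 : ∀ pp x, tq pp x ≠ 0)
  (htq1 : ∀ (pp : Nat.Primes) (x : (thetaIndex X).Fibre (.inr pp)),
    haveI : Fact (pp : ℕ).Prime := ⟨pp.2⟩; placeOf X pp.1 x ∉ X.S → ‖tq pp x‖ = 1)

/-- **ROW 8, ROUND 2 Q2(8): «S restricted to Σ₈» IS A THEOREM OF THE CANDIDATE — `HBand X` alone gives the (xi-f) hull clause at every packet.**
For ANY Dupuy–Hilado pilot datum `X` with `2l ∣ ord_w(q_w)` on `S` ([IUTchI] Ex. 3.2 (iv)), ANY context binders of abc-iut-c312-7's print-normalised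
sharp setting, and ANY idele pair `(t_q, t_Θ)` REALISING `(P_q, P_Θ)` in the completions (non-zero, units off `S`, Dupuy–Hilado's normalisation
(3.4)): if abc-iut-lens-strengthen-1's row-8 candidate `RHHeightClass.HBand X` holds — i.e. the datum lies in the stratum Σ₈ of
`plan/rescue/R-H/ROUND1.tsv` row 8 (closed form on HEX data `k ≤ k₀(p,e_w,l)`, `RHHeightClass.hexSlice_iff`) — then
`qRegion ⊆ thetaHull` at EVERY packet `(j, v_ℚ)` of `settingPrVolSharp X …`: the body of the binder `hSHw` of `Conditional.abc_of_SH_v10K_window`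
(p447945) for this datum, with NO dictionary / profile binder left. PROOF: §3 reads the uniform dictionary `(e_p, r_p)` and the integer orders
off the candidate and Ex. 3.2 (iv); abc-iut-rp-m2's `RHHeightClassGlue.slotReachWindow_of_hBand` (p460910) gives abc-iut-lens-wuc-1's window at it;
§1 moves the window to the per-place dictionary `e_x = ramIdx`, `n₀ = 1`, `λ_x = −r_p/e_p` (bad primes) / `−(⌊e_x/(p−1)⌋+1)/e_x` (silent primes),
whose certificates are abc-iut-S7's norm uniformizers (`exists_isUniformizer_rescaledCompletion`), abc-iut-rh-typ-12's `RHSlotReach.exists_hsharp_one`,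
abc-iut-rp-m2's `exists_mem_logUnits_rpow_le_of_certVal` / `…_div_succ`; §4 turns realisation into the norm profile; §2 (abc-iut-rp-d3's door,
column-free) concludes. [cite: DupuyHilado2025, §3.3, §3.4, §3.9, §4.9] [cite: WeilBNT1967, Ch. II §2, Th. 1] [cite: NeukirchANT1999, Ch. II Prop. (5.5), (6.8)]
[cite: Mochizuki2012, IUTchI Ex. 3.2 (iv) p. 71; IUTchIII Cor. 3.12 Step (xi-f) p. 184] [claim: Mochizuki2012, status: disputed] -/
theorem qRegion_subset_thetaHull_settingPrVolSharp_of_hBand (h2l : Cor312Prov.TwoMulLDvdOrdq X)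
    (htq : ∀ (pp : Nat.Primes) (x : (thetaIndex X).Fibre (.inr pp)), haveI : Fact (pp : ℕ).Prime := ⟨pp.2⟩
      Real.log ‖tq pp x‖ = -(X.qPilot (placeOf X pp.1 x)) * logNorm F (placeOf X pp.1 x) / localDegree F (placeOf X pp.1 x))
    (ht0 : ∀ pp i x, t pp i x ≠ 0)
    (ht1 : ∀ (pp : Nat.Primes) (i : Fin X.lstar) (x : (thetaIndex X).Fibre (.inr pp)),
      haveI : Fact (pp : ℕ).Prime := ⟨pp.2⟩; placeOf X pp.1 x ∉ X.S → ‖t pp i x‖ = 1)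
    (ht : ∀ (pp : Nat.Primes) (i : Fin X.lstar) (x : (thetaIndex X).Fibre (.inr pp)), haveI : Fact (pp : ℕ).Prime := ⟨pp.2⟩
      Real.log ‖t pp i x‖ = -(X.thetaPilot i (placeOf X pp.1 x)) * logNorm F (placeOf X pp.1 x) / localDegree F (placeOf X pp.1 x))
    (hH : RHHeightClass.HBand X) :
    ∀ (j : (thetaIndex X).Label) (vQ : (thetaIndex X).VQ),
      (settingPrVolSharp X hlog M archPk archSub Ψ act Mmod region n lat sig split qData tq t htq0 htq1).qRegion j vQ ⊆
        (settingPrVolSharp X hlog M archPk archSub Ψ act Mmod region n lat sig split qData tq t htq0 htq1).thetaHull j vQ := by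
  classical
  haveI hne : ∀ pp : Nat.Primes, Fact (pp : ℕ).Prime := fun pp => ⟨pp.2⟩
  have i₀ : Fin X.lstar := ⟨0, by have := X.two_le_lstar; omega⟩
  -- §3: the uniform dictionary `(e_p, r_p)` read off the candidate, and the integer orders `m_q`
  obtain ⟨eK, heK, hram⟩ := exists_uniformIdx_of_hBand X hH
  have hrKex : ∀ pp : Nat.Primes, ∃ r : ℤ, RHHeightClass.CertVal pp (eK pp) r ∧
      ∀ r' : ℤ, RHHeightClass.CertVal pp (eK pp) r' → r ≤ r' := fun pp => exists_lowerCert pp (eK pp) (heK pp)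
  choose rK hrKcert hrKle using hrKex
  let mq : ∀ pp : Nat.Primes, (thetaIndex X).Fibre (.inr pp) → ℤ := fun pp w => X.ordq (placeOf X pp.1 w) / (2 * (X.l : ℤ))
  have hmq : ∀ (pp : Nat.Primes) (w : (thetaIndex X).Fibre (.inr pp)), placeOf X pp.1 w ∈ X.S →
      (mq pp w : ℝ) = X.qPilot (placeOf X pp.1 w) := fun pp w hw => intOrder_cast_eq_qPilot X h2l hw
  -- abc-iut-rp-m2 (p460910): the window at the uniform dictionary
  have hW := RHHeightClassGlue.slotReachWindow_of_hBand X eK rK heK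
    (e := fun pp _ => eK pp) (n₀ := fun _ _ => 1) (lam := fun pp _ => -((rK pp : ℤ) : ℝ) / ((eK pp : ℕ) : ℝ))
    (mΘ := fun pp i w => ((((i : ℕ) : ℤ) + 1) ^ 2) * mq pp w) (mq := mq)
    (fun _ _ => rfl) (fun _ _ => rfl) (fun _ _ => rfl) (fun _ _ _ => rfl)
    (fun pp w hw => hram pp w hw w) hmq (fun pp w _ r hr => hrKle pp r hr) hH
  -- §1: move it to the per-place dictionary (true index everywhere; the candidate's exponent over bad primes, the envelope elsewhere)
  let e' : ∀ pp : Nat.Primes, (thetaIndex X).Fibre (.inr pp) → ℕ := fun pp x => ramIdx F (placeOf X pp.1 x)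
  let lam' : ∀ pp : Nat.Primes, (thetaIndex X).Fibre (.inr pp) → ℝ := fun pp x =>
    if ∃ w : (thetaIndex X).Fibre (.inr pp), placeOf X pp.1 w ∈ X.S then -((rK pp : ℤ) : ℝ) / ((eK pp : ℕ) : ℝ)
    else -(((ramIdx F (placeOf X pp.1 x) / ((pp : ℕ) - 1) + 1 : ℕ) : ℝ)) / (ramIdx F (placeOf X pp.1 x) : ℝ)
  have hW' : SlotReachWindow (thetaIndex X).lstar (fun pp => (thetaIndex X).Fibre (.inr pp))
      (fun pp w => placeOf X pp.1 w ∈ X.S) e' (fun _ _ => 1) lam' (fun pp i w => ((((i : ℕ) : ℤ) + 1) ^ 2) * mq pp w) mq :=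
    slotReachWindow_congr (fun pp w hw x => by simp only [e', hram pp w hw x]) (fun _ _ _ _ => rfl)
      (fun pp w hw x => by simp only [lam', if_pos (⟨w, hw⟩ : ∃ w : (thetaIndex X).Fibre (.inr pp), placeOf X pp.1 w ∈ X.S)]) hW
  -- norm uniformizers at every place (abc-iut-S7)
  have hϖex : ∀ (pp : Nat.Primes) (x : (thetaIndex X).Fibre (.inr pp)),
      ∃ ϖ : kOf X pp.1 x, ‖ϖ‖ = (pp : ℝ) ^ (-(1 : ℝ) / (e' pp x : ℝ)) := by
    intro pp x
    obtain ⟨ϖ, -, hnorm⟩ := exists_isUniformizer_rescaledCompletion F pp.1 (placeOf X pp.1 x) (natCast_mem_placeOf X pp.1 x)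
    refine ⟨(ϖ : kOf X pp.1 x), ?_⟩
    rw [hnorm, ← ramIdx_eq F (placeOf X pp.1 x)]
    congr 1
    simp only [e']
    ring
  choose ϖ hϖ using hϖex
  -- §2: abc-iut-rp-d3's door, column-free, at this dictionary
  refine qRegion_subset_thetaHull_settingPrVolSharp_of_slotReachWindow X hlog M archPk archSub Ψ act Mmod region n lat sig split qData
    tq t htq0 htq1 e' (fun _ _ => 1) lam' ϖ (fun pp i w => ((((i : ℕ) : ℤ) + 1) ^ 2) * mq pp w) mq
    (fun pp x => norm_le_one_of_log_realising X pp x (htq0 pp x) (htq pp x))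
    (fun pp x => Nat.one_le_iff_ne_zero.2 (ramIdx_ne_zero F _)) hϖ
    (fun pp x => exists_hsharp_one (pp : ℕ) (kOf X pp.1 x) (ϖ pp x)) (fun pp x => ?_) ht1 (fun pp i w hw => ?_)
    (fun pp w hw => ?_) hW'
  · -- `hrad`: the candidate's certified exponent over a bad prime (`p` odd), the envelope exponent elsewhere (any `p`)
    by_cases hbad : ∃ w : (thetaIndex X).Fibre (.inr pp), placeOf X pp.1 w ∈ X.S
    · obtain ⟨w, hw⟩ := hbad
      have hp2 : 2 < (pp : ℕ) := (hH pp i₀ w hw).1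
      have hex : ramIdx F (placeOf X pp.1 x) = eK pp := hram pp w hw x
      have hcert : RHHeightClass.CertVal pp (ramIdx F (placeOf X pp.1 x)) (rK pp) := by rw [hex]; exact hrKcert pp
      obtain ⟨z, hz, hle⟩ := RHHeightClassGlue.exists_mem_logUnits_rpow_le_of_certVal X pp.1 hp2 x hcert
      refine ⟨z, hz, le_of_eq_of_le ?_ hle⟩
      simp only [lam', if_pos (⟨w, hw⟩ : ∃ w : (thetaIndex X).Fibre (.inr pp), placeOf X pp.1 w ∈ X.S), hex]
    · obtain ⟨z, hz, hle⟩ := RHHeightClassGlue.exists_mem_logUnits_rpow_le_div_succ X pp.1 x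
      refine ⟨z, hz, le_of_eq_of_le ?_ hle⟩
      simp only [lam', if_neg hbad]
  · -- `hΘ`: the Θ-idele realises `P_{Θ,j}(w) = j²·P_q(w) = j²·m_q(w)`
    refine norm_eq_uniformizer_zpow_of_log X pp w (ht0 pp i w) (hϖ pp w) ?_ (ht pp i w)
    push_cast
    rw [hmq pp w hw, X.thetaPilot_apply_of_mem i hw, X.qPilot_apply_of_mem hw]
    ring
  · -- `hq`: the q-idele realises `P_q(w) = m_q(w)`
    exact norm_eq_uniformizer_zpow_of_log X pp w (htq0 pp w) (hϖ pp w) (hmq pp w hw) (htq pp w)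

end Main

end Summit.ABC.IUTFork.Repair.RHHeightClassSigma

end
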